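import Literature.Analysis.FluidPDE.ElgindiThetaZeroEstimates
import Literature.Analysis.FluidPDE.ElgindiBoundaryClassesZero
import HarnessLib

/-!
# All `θ`-derivatives of the tangential family extend continuously to `θ = 0`
([Elgindi2021] §7.1 Proposition 7.1: regularity of the `L²` solution at the boundary `θ = 0`)

Topic `Literature/Analysis/FluidPDE`. Proof file (everything proved, no definitions, no named
facts) on the proof path of the named fact
`Literature.Analysis.FluidPDE.Elgindi.ElgindiGhoulMasmoudi2021_stabilityCore`
(`ElgindiStabilityDecomposition.lean`). T. M. Elgindi, Ann. of Math. 194 (2021) =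
arXiv:1904.04795, §7.1 Proposition 7.1 (p. 19) and §7 eq. (PolarBSL).

The bootstrap at the regular boundary `θ = 0`: for a `TangentialFamily` (`V_k = D_R^kΨ` solving
`L(V_k) = D_R^kf`, with finite tangential and Hardy energies) every `∂_θ^l V_k` extends jointly
continuously to `θ = 0` on `(0,∞) × [0,π/4)` (`extZeroUpTo_iterate`). Induction on `l`
simultaneously for all `k`: orders `0, 1` come from the uniform `√θ`-rates of
`ElgindiThetaZeroEstimates.lean`; the step uses the equation solved for `∂_θθV_k`,
`∂_θθV_k = tan θ∂_θV_k + V_k/cos²θ − 6V_k − D_R^kf − α²(V_{k+2} − V_{k+1}) − α(5+α)V_{k+1}`, and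
the closure properties of the classes (`ElgindiBoundaryClassesZero.lean`).
-/

noncomputable section

open MeasureTheory Set Real Filter Function
open _root_.Topology
open scoped ContDiff

namespace Literature.Analysis.FluidPDE

namespace Elgindi

/-! ### Coefficients: `tan θ`, `1/cos²θ`, and smooth global functions -/

/-- Iterated `∂_θ` of a function of `θ` alone. [folklore] -/
theorem iterate_dθ_of_theta (φ : ℝ → ℝ) (l : ℕ) : (dθ^[l] fun (_ : ℝ) θ => φ θ) = fun _ θ => (deriv^[l] φ) θ := by
  induction l generalizing φ with
  | zero => rfl
  | succ l ih =>
    rw [Function.iterate_succ_apply, Function.iterate_succ_apply]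
    have e : dθ (fun (_ : ℝ) θ => φ θ) = fun _ θ => deriv φ θ := by funext R θ; rfl
    rw [e, ih (deriv φ)]

/-- Iterated derivatives of a function smooth on `(−π/2, π/2)` are smooth there. [folklore] -/
theorem contDiffOn_iterate_deriv_Ioo {φ : ℝ → ℝ} (hφ : ContDiffOn ℝ ∞ φ (Ioo (-(π / 2)) (π / 2))) (l : ℕ) :
    ContDiffOn ℝ ∞ (deriv^[l] φ) (Ioo (-(π / 2)) (π / 2)) := by
  induction l with
  | zero => exact hφ
  | succ l ih => rw [Function.iterate_succ_apply']; exact ih.deriv_of_isOpen isOpen_Ioo (by simp)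

/-- **A function of `θ` smooth on `(−π/2, π/2)` is a coefficient on every slab `[0,c)`, `c ≤ π/2`.** [folklore] -/
theorem isCoef_of_theta {c : ℝ} (hcπ : c ≤ π / 2) {φ : ℝ → ℝ} (hφ : ContDiffOn ℝ ∞ φ (Ioo (-(π / 2)) (π / 2))) :
    IsCoef c (fun _ θ => φ θ) := by
  refine ⟨fun l => ?_, ?_⟩
  · rw [iterate_dθ_of_theta]
    have hc := (contDiffOn_iterate_deriv_Ioo hφ l).continuousOn
    exact hc.comp continuous_snd.continuousOn fun p hp => ⟨by linarith [hp.2.1, Real.pi_pos], hp.2.2.trans_le hcπ⟩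
  · exact hφ.comp contDiffOn_snd fun p hp => ⟨by linarith [hp.2.1, Real.pi_pos], hp.2.2⟩

/-- `tan` is smooth on `(−π/2, π/2)`. [folklore] -/
theorem contDiffOn_tan_Ioo : ContDiffOn ℝ ∞ Real.tan (Ioo (-(π / 2)) (π / 2)) := fun _ hθ =>
  (Real.contDiffAt_tan.2 (Real.cos_pos_of_mem_Ioo hθ).ne').contDiffWithinAt

/-- `1/cos²` is smooth on `(−π/2, π/2)`. [folklore] -/
theorem contDiffOn_inv_cos_sq_Ioo : ContDiffOn ℝ ∞ (fun θ => 1 / Real.cos θ ^ 2) (Ioo (-(π / 2)) (π / 2)) :=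
  contDiffOn_const.div (Real.contDiff_cos.pow 2).contDiffOn fun _ hθ => pow_ne_zero 2 (Real.cos_pos_of_mem_Ioo hθ).ne'

/-- **Globally smooth functions belong to all classes.** [folklore] -/
theorem extZeroUpTo_of_contDiff {c : ℝ} (hc : 0 < c) {g : ℝ → ℝ → ℝ} (hg : ∀ n : ℕ, ContDiff ℝ n (uncurry g)) (m : ℕ) :
    ExtZeroUpTo c m g := by
  intro l _
  have hl : ContDiff ℝ 0 (uncurry (dθ^[l] g)) := by
    have : ∀ (l : ℕ) {g : ℝ → ℝ → ℝ}, (∀ n : ℕ, ContDiff ℝ n (uncurry g)) → ∀ n : ℕ, ContDiff ℝ n (uncurry (dθ^[l] g)) := by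
      intro l
      induction l with
      | zero => intro g hg n; exact hg n
      | succ l ih =>
        intro g hg n
        rw [Function.iterate_succ_apply]
        exact ih (fun n => contDiff_dθ_of_contDiff (n := n) (hg (n + 1))) n
    exact this l hg 0
  refine extZero_of_continuousOn hc (g₀ := fun R => (dθ^[l] g) R 0) ?_
  have hcont : Continuous fun p : ℝ × ℝ => (dθ^[l] g) p.1 p.2 := hl.continuous
  refine hcont.continuousOn.congr fun p hp => ?_
  by_cases h0 : p.2 ≤ 0
  · have hz : p.2 = 0 := le_antisymm h0 hp.2.1
    rw [if_pos h0]
    show (dθ^[l] g) p.1 0 = (dθ^[l] g) p.1 p.2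
    rw [hz]
  · rw [if_neg h0]

/-! ### The bootstrap -/

namespace TangentialFamily

variable {α : ℝ} {f Ψ : ℝ → ℝ → ℝ} (h : TangentialFamily α f Ψ)
include h

/-- Order zero: `V_k` extends (by `0`). [folklore] -/
theorem extZero_iterate (k : ℕ) : ExtZero (π / 4) (Dz^[k] Ψ) := by
  have hπ4 : (0:ℝ) < π / 4 := by positivity
  refine extZero_of_continuousOn hπ4 (g₀ := fun _ => 0) ?_
  exact (h.continuousOn_ext_zero k).mono (prod_mono le_rfl (Ico_subset_Ico le_rfl (by linarith [Real.pi_pos])))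

/-- Order one: `∂_θV_k` extends (by `∂_θV_k(R,0⁺)`). [folklore] -/
theorem extZero_dθ_iterate (k : ℕ) : ExtZero (π / 4) (dθ (Dz^[k] Ψ)) :=
  extZero_of_continuousOn (by positivity) (h.continuousOn_dθ_ext_zero k)

/-- The datum iterates belong to all classes. [folklore] -/
theorem extZeroUpTo_datum (k m : ℕ) : ExtZeroUpTo (π / 4) m (Dz^[k] f) :=
  extZeroUpTo_of_contDiff (by positivity) (fun n => contDiff_iterate_Dz_of_contDiff (n := n) (m := k) (by simpa using h.datum_smooth (n + k))) m

/-- **All `θ`-derivatives of every `V_k` extend jointly continuously to `θ = 0`** on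
`(0,∞) × [0,π/4)`. [cite: Elgindi2021, §7.1 Proposition 7.1 (p. 19 of arXiv:1904.04795)] -/
theorem extZeroUpTo_iterate (m : ℕ) : ∀ k : ℕ, ExtZeroUpTo (π / 4) m (Dz^[k] Ψ) := by
  have hπ4 : (0:ℝ) < π / 4 := by positivity
  have hπ42 : π / 4 ≤ π / 2 := by linarith [Real.pi_pos]
  induction m using Nat.strong_induction_on with
  | _ m ih =>
    intro k
    rcases m with _ | m
    · intro l hl; have : l = 0 := Nat.le_zero.1 hl; subst this; exact h.extZero_iterate k
    rcases m with _ | m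
    · exact extZeroUpTo_succ_iff.2 ⟨h.extZero_iterate k, fun l hl => by
        have : l = 0 := Nat.le_zero.1 hl; subst this; exact h.extZero_dθ_iterate k⟩
    -- `m + 2`: reduce to `∂_θθV_k ∈ ExtZeroUpTo (π/4) m` via the equation
    have IH1 : ∀ k, ExtZeroUpTo (π / 4) (m + 1) (Dz^[k] Ψ) := ih (m + 1) (by omega)
    have IH0 : ∀ k, ExtZeroUpTo (π / 4) m (Dz^[k] Ψ) := fun k => (IH1 k).of_le (Nat.le_succ m)
    refine extZeroUpTo_succ_iff.2 ⟨h.extZero_iterate k, extZeroUpTo_succ_iff.2 ⟨h.extZero_dθ_iterate k, ?_⟩⟩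
    have hdθ : ExtZeroUpTo (π / 4) m (dθ (Dz^[k] Ψ)) := (extZeroUpTo_succ_iff.1 (IH1 k)).2
    -- smoothness on the strip of the players
    have sV : ∀ j, ContDiffOn ℝ ∞ (uncurry (Dz^[j] Ψ)) strip := h.smooth_iterate
    have sdV : ContDiffOn ℝ ∞ (uncurry (dθ (Dz^[k] Ψ))) strip := contDiffOn_dθ_strip (sV k)
    have sd : ContDiffOn ℝ ∞ (uncurry (Dz^[k] f)) strip :=
      (contDiff_infty.2 fun n => contDiff_iterate_Dz_of_contDiff (n := n) (m := k) (by simpa using h.datum_smooth (n + k))).contDiffOn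
    have cT : IsCoef (π / 4) (fun _ θ => Real.tan θ) := isCoef_of_theta hπ42 contDiffOn_tan_Ioo
    have cS : IsCoef (π / 4) (fun _ θ => 1 / Real.cos θ ^ 2) := isCoef_of_theta hπ42 contDiffOn_inv_cos_sq_Ioo
    -- the right-hand side, term by term
    have t1 : ExtZeroUpTo (π / 4) m (fun R θ => Real.tan θ * dθ (Dz^[k] Ψ) R θ) := ExtZeroUpTo.coef_mul hπ4 hπ42 m cT sdV hdθ
    have t2 : ExtZeroUpTo (π / 4) m (fun R θ => (1 / Real.cos θ ^ 2) * (Dz^[k] Ψ) R θ) := ExtZeroUpTo.coef_mul hπ4 hπ42 m cS (sV k) (IH0 k)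
    have t3 : ExtZeroUpTo (π / 4) m (fun R θ => 6 * (Dz^[k] Ψ) R θ) := (IH0 k).const_mul hπ4 6
    have t4 : ExtZeroUpTo (π / 4) m (Dz^[k] f) := h.extZeroUpTo_datum k m
    have t5 : ExtZeroUpTo (π / 4) m (fun R θ => α ^ 2 * ((Dz^[k + 2] Ψ) R θ - (Dz^[k + 1] Ψ) R θ)) :=
      ((IH0 (k + 2)).sub hπ4 hπ42 (sV (k + 2)) (sV (k + 1)) (IH0 (k + 1))).const_mul hπ4 (α ^ 2)
    have t6 : ExtZeroUpTo (π / 4) m (fun R θ => α * (5 + α) * (Dz^[k + 1] Ψ) R θ) := (IH0 (k + 1)).const_mul hπ4 _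
    -- smoothness of the partial sums
    have s1 : ContDiffOn ℝ ∞ (uncurry fun R θ => Real.tan θ * dθ (Dz^[k] Ψ) R θ) strip := contDiffOn_mul_strip cT.2 sdV
    have s2 : ContDiffOn ℝ ∞ (uncurry fun R θ => (1 / Real.cos θ ^ 2) * (Dz^[k] Ψ) R θ) strip := contDiffOn_mul_strip cS.2 (sV k)
    have s3 : ContDiffOn ℝ ∞ (uncurry fun R θ => 6 * (Dz^[k] Ψ) R θ) strip := contDiffOn_const.mul (sV k)
    have s5 : ContDiffOn ℝ ∞ (uncurry fun R θ => α ^ 2 * ((Dz^[k + 2] Ψ) R θ - (Dz^[k + 1] Ψ) R θ)) strip :=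
      contDiffOn_const.mul ((sV (k + 2)).sub (sV (k + 1)))
    have s6 : ContDiffOn ℝ ∞ (uncurry fun R θ => α * (5 + α) * (Dz^[k + 1] Ψ) R θ) strip := contDiffOn_const.mul (sV (k + 1))
    have s12 := contDiffOn_add_strip s1 s2
    have s123 : ContDiffOn ℝ ∞ (uncurry fun R θ => (Real.tan θ * dθ (Dz^[k] Ψ) R θ + 1 / Real.cos θ ^ 2 * (Dz^[k] Ψ) R θ) - 6 * (Dz^[k] Ψ) R θ) strip :=
      s12.sub s3
    have s1234 : ContDiffOn ℝ ∞ (uncurry fun R θ => (Real.tan θ * dθ (Dz^[k] Ψ) R θ + 1 / Real.cos θ ^ 2 * (Dz^[k] Ψ) R θ - 6 * (Dz^[k] Ψ) R θ) - (Dz^[k] f) R θ) strip :=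
      s123.sub sd
    have s12345 : ContDiffOn ℝ ∞ (uncurry fun R θ => (Real.tan θ * dθ (Dz^[k] Ψ) R θ + 1 / Real.cos θ ^ 2 * (Dz^[k] Ψ) R θ - 6 * (Dz^[k] Ψ) R θ - (Dz^[k] f) R θ) -
        α ^ 2 * ((Dz^[k + 2] Ψ) R θ - (Dz^[k + 1] Ψ) R θ)) strip := s1234.sub s5
    -- assemble
    have hsum := ((((t1.add hπ4 hπ42 s1 s2 t2).sub hπ4 hπ42 s12 s3 t3).sub hπ4 hπ42 s123 sd t4).sub hπ4 hπ42 s1234 s5 t5).sub hπ4 hπ42 s12345 s6 t6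
    refine (extZeroUpTo_congr hπ42 (fun p hp => ?_)).2 hsum
    rw [h.dθdθ_iterate_eq k hp]
    ring

/-- **Corollary**: every `∂_θ^lV_k`, extended to `θ = 0` by its one-sided limit, is jointly
continuous on `(0,∞) × [0,π/4)`. [cite: Elgindi2021, §7.1 Proposition 7.1 (p. 19 of arXiv:1904.04795)] -/
theorem continuousOn_bext_iterate (k l : ℕ) : ContinuousOn (bext (dθ^[l] (Dz^[k] Ψ))) (Ioi 0 ×ˢ Ico 0 (π / 4)) :=
  h.extZeroUpTo_iterate l k l le_rfl

end TangentialFamily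

end Elgindi

end Literature.Analysis.FluidPDE
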